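import Summits.CriticalPhenomena.PercolationContinuityZ3.Theorems.SubpolynomialBlocking.Negative.Strengthenings
import Literature.Probability.Percolation.HalfSpaceBrickUp

/-!
# `SubpolynomialBlocking` — negative knowledge IV: the surface-order floor is attained at `n = 1`

Support file for crux item stmt-CriticalPhenomena-4446 (`PercNonProliferation.SubpolynomialBlocking`), written by the
crux's standing disprover (Cruxes/SubpolynomialBlocking/Disproof.lean, §7). TIGHTNESS of the floor
`(1-p)^{|∂_E Λ_n|} ≤ u_n` of `Negative/Strengthenings.lean`: at `n = 1` it is an EQUALITY,
`u_1(d,p) = (1-p)^{|∂_E Λ_1|}` (`blockProb_one_eq`) — the annulus `Λ_2 ∖ Λ_1` is blocked iff every lattice edge leaving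
`Λ_1` is closed, since each such edge lands on `∂ⁱⁿΛ_2`. On `ℤ³` at `p_c ≈ 0.2488`: `u_1 = (1-p_c)^{54} ≈ 1.9·10⁻⁷`,
the order of magnitude of the constants implicit in the crux (consistent with Monte Carlo: 0 blocked in 2·10⁴ samples,
kit job j013791).
-/

noncomputable section

namespace Summit.CriticalPhenomena.PercolationContinuityZ3.Theorems.SubpolynomialBlocking.Negative

open MeasureTheory Filter Topology
open Literature.Probability.Percolation Literature.Probability.LatticeModels
open Literature.Barriers.CriticalPhenomena
open Literature.Probability.Percolation.DCT16
open Summit.CriticalPhenomena.PercolationContinuityZ3.Theses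

/-- **The floor is ATTAINED at `n = 1`** (tightness of §7): `u_1(d,p) = (1-p)^{|∂_E Λ_1|}` exactly — the annulus
`Λ_2 ∖ Λ_1` is blocked iff every lattice edge leaving `Λ_1` (each lands on `∂ⁱⁿΛ_2`) is closed. On `ℤ³` at `p_c`:
`u_1 = (1 - p_c)^{54} ≈ 1.9·10⁻⁷` — the size of the constants hidden in the crux. -/
theorem blockProb_one_eq (d : ℕ) (p : unitInterval) :
    blockProb d p 1 = (1 - (p : ℝ)) ^ (edgeBoundary (zdGraph d) (box d 1)).card := by
  have hF : (↑(edgeBoundary (zdGraph d) (box d 1)) : Set (Sym2 (Site d))) ⊆ (zdGraph d).edgeSet :=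
    fun e he => (mem_edgeBoundary_iff.1 (Finset.mem_coe.1 he)).1
  refine le_antisymm ?_ (pow_card_edgeBoundary_le_blockProb le_rfl p)
  rw [← BGN.bondPercolation_real_forall_notMem_eq (zdGraph d) p _ hF]
  refine real_mono_of_forall_subset_edgeSet (zdGraph d) p fun ω hω hb => ?_
  intro e he heω
  obtain ⟨hE, ⟨x, hx, hxe⟩, ⟨y, hy, hye⟩⟩ := mem_edgeBoundary_iff.1 he
  have hxy : x ≠ y := fun h => hy (h ▸ hx)
  have hexy : e = s(x, y) := (Sym2.mem_and_mem_iff hxy).1 ⟨hxe, hye⟩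
  subst hexy
  have hadj : (zdGraph d).Adj x y := hE
  have hy2 : y ∈ box d 2 := DCT16.mem_box_succ_of_adj hx hadj
  -- `y ∉ Λ_1`, `y ∈ Λ_2`, neighbour of a site of `Λ_1`: some coordinate of `y` has absolute value `2`
  have hyb : y ∈ innerBoundary (zdGraph d) (box d (2 * 1)) := by
    rw [mem_box, not_forall] at hy
    obtain ⟨i, hi⟩ := hy
    have h1 := (mem_box.1 hx) i
    have h2 := (mem_box.1 hy2) i
    have h3 := DCT16.abs_sub_le_one_of_adj hadj i
    refine mem_innerBoundary_box_of_natAbs_eq hy2 (i := i) ?_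
    rw [abs_le] at h3
    push_cast at h1 h2 hi ⊢
    omega
  refine hb ⟨x, hx, y, hyb, mem_openConnIn_of_pathIn (PathIn.of_adj ?_ ?_ ?_)⟩
  · exact Finset.mem_coe.2 (box_mono d (by norm_num) hx)
  · exact Finset.mem_coe.2 hy2
  · exact (openGraph_adj ω x y).2 ⟨heω, hxy⟩


end Summit.CriticalPhenomena.PercolationContinuityZ3.Theorems.SubpolynomialBlocking.Negative
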